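import Summits.Ventures.PercRepro.MSTightDefect

/-!
# The defect of a near-member determines it (Lemma U), part 2: case β and the assembly

Continuation of `MSTightDefect.lean`: with `M = Rstar F`, `N = Mᶜ`, `σ M = true` and the defect
`e = N \ u`, the part `M ∩ u` is the union of the twin classes `q ⊆ M` that are differences whose
member `M \ q` is an agreement member (`mem_iff_of_sdiff_Rstar_eq`). Together with case α this
gives **Lemma U** (`eq_of_cells_subset_insert`): for a tight nonempty `F`, a sign pattern `σ`
and a non-difference `e`, at most one set `u` with `u, uᶜ ∉ F` has all its required cells in
`F \\ F ∪ {e}` — the defect determines the near-member. Finally `mem_or_compl_mem_of_tight_insert`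
records the «missing member» reduction: when `F ∪ {u}` is tight, a second near-member `u'` whose
required cells and mutual differences with `u` are differences of `F ∪ {u}` is `u` or `uᶜ` up to
membership — the general mixed-cell lemma applied to the tight extension.
-/

namespace PercRepro.MSTight

open Finset
open scoped FinsetFamily symmDiff

variable {α : Type*} [DecidableEq α] [Fintype α]

section LemmaU

/-- **Case β.** If `σ (Rstar F) = true` and the defect is `(Rstar F)ᶜ \ u`, then for
`p ∈ Rstar F`: `p ∈ u` iff the class of `p` is a difference whose member `Rstar F \ cls` is an
agreement member. -/
theorem mem_iff_of_sdiff_Rstar_eq {F : Finset (Finset α)} (hF : Tight F) (hne : F.Nonempty)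
    (σ : Finset α → Bool) {e : Finset α} (he : e ∉ F \\ F) {u : Finset α} (hu : u ∉ F)
    (h : ∀ t ∈ F, Cells (insert e (F \\ F)) t (if σ t = true then u else Finset.univ \ u))
    (hσ : σ (Rstar F) = true) (hae : (Finset.univ \ Rstar F) \ u = e) {p : α}
    (hp : p ∈ Rstar F) :
    p ∈ u ↔ (cls F p ∈ F \\ F ∧ σ (Rstar F \ cls F p) = true) := by
  set M := Rstar F with hM
  set N := Finset.univ \ M with hN
  set D := F \\ F with hD
  have hdich := dichotomy_of_tight hF
  have hMtc : TwinClosed F M := twinClosed_Rstar F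
  have hNtc : TwinClosed F N := (twinClosed_univ F).sdiff hMtc
  have hMF : M ∈ F := Rstar_mem_of_dichotomy hdich hne
  have hene : e ≠ ∅ := ne_empty_of_notMem_diffs hne he
  have heN : e ⊆ N := hae ▸ sdiff_subset
  have heM : Disjoint e M := disjoint_left.2 fun x hx hxM => (mem_sdiff.1 (heN hx)).2 hxM
  -- the first cell at `M`: `M ∩ u ∈ D`
  have hb : M ∩ u ∈ D := by
    have := (h M hMF).1
    rw [hσ] at this
    simp only [if_true] at this
    rcases mem_insert.1 this with h1 | h1
    · exfalso
      apply hene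
      rw [eq_empty_iff_forall_notMem]
      intro x hx
      have h2 := heN hx
      rw [← h1] at hx
      exact (mem_sdiff.1 h2).2 (mem_inter.1 hx).1
    · exact h1
  have hq : cls F p ⊆ M := cls_subset_of_twinClosed hMtc hp
  have hqtc : TwinClosed F (cls F p) := twinClosed_cls F p
  by_cases hqD : cls F p ∈ D
  · -- the member `M \ q`
    have htF : M \ cls F p ∈ F := by
      have := union_sdiff_mem_of_tight hF (empty_mem_diffs_of_nonempty hne) (empty_subset _)
        hqD hq
      rwa [empty_union] at this
    by_cases hσt : σ (M \ cls F p) = true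
    · -- agreement member: the cell `e ∪ (q \ u)` must be the defect, so `q ⊆ u`
      refine ⟨fun _ => ⟨hqD, hσt⟩, fun _ => ?_⟩
      have hc := (h _ htF).2
      rw [if_pos hσt] at hc
      have e1 : (Finset.univ \ (M \ cls F p)) ∩ (Finset.univ \ u) = e ∪ (cls F p \ u) := by
        rw [← hae]
        ext x
        simp only [mem_inter, mem_sdiff, mem_union, mem_univ, true_and, hN]
        constructor
        · rintro ⟨hx, hxu⟩
          by_cases hxM : x ∈ M
          · exact Or.inr ⟨by tauto, hxu⟩
          · exact Or.inl ⟨hxM, hxu⟩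
        · rintro (⟨hxM, hxu⟩ | ⟨hxq, hxu⟩)
          · exact ⟨fun h' => hxM h'.1, hxu⟩
          · exact ⟨fun h' => h'.2 hxq, hxu⟩
      rw [e1] at hc
      rcases mem_insert.1 hc with h1 | h1
      · by_contra hpu
        have : p ∈ e ∪ (cls F p \ u) := mem_union.2 (Or.inr (mem_sdiff.2 ⟨self_mem_cls F p, hpu⟩))
        rw [h1] at this
        exact disjoint_left.1 heM this hp
      · exfalso
        have := inter_mem_diffs_of_twinClosed hF h1 hNtc
        have e2 : (e ∪ (cls F p \ u)) ∩ N = e := by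
          ext x
          simp only [mem_inter, mem_union, mem_sdiff]
          constructor
          · rintro ⟨hxe | ⟨hxq, _⟩, hxN⟩
            · exact hxe
            · exact absurd (hq hxq) (mem_sdiff.1 hxN).2
          · intro hxe
            exact ⟨Or.inl hxe, heN hxe⟩
        rw [e2] at this
        exact he this
    · -- disagreement member: the cells of `uᶜ`; `p ∈ u` would make `u` a member
      have hnot : p ∉ u := by
        intro hpu
        have hc := h _ htF
        rw [if_neg hσt] at hc
        obtain ⟨hc1, hc2⟩ := hc
        rw [Finset.sdiff_sdiff_eq_self (subset_univ u)] at hc2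
        have e1 : (M \ cls F p) ∩ (Finset.univ \ u) = (M \ cls F p) \ u := by
          ext x; simp only [mem_inter, mem_sdiff, mem_univ, true_and]
        have e2 : (Finset.univ \ (M \ cls F p)) ∩ u = (N ∩ u) ∪ (cls F p ∩ u) := by
          ext x
          simp only [mem_inter, mem_sdiff, mem_union, mem_univ, true_and, hN]
          constructor
          · rintro ⟨hx, hxu⟩
            by_cases hxM : x ∈ M
            · exact Or.inr ⟨by tauto, hxu⟩
            · exact Or.inl ⟨hxM, hxu⟩
          · rintro (⟨hxM, hxu⟩ | ⟨hxq, hxu⟩)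
            · exact ⟨fun h' => hxM h'.1, hxu⟩
            · exact ⟨fun h' => h'.2 hxq, hxu⟩
        rw [e1] at hc1
        rw [e2] at hc2
        -- the second cell is a difference (it cannot be `e`)
        have hc2D : (N ∩ u) ∪ (cls F p ∩ u) ∈ D := by
          rcases mem_insert.1 hc2 with h1 | h1
          · exfalso
            -- `p ∈ q ∩ u ⊆ e ⊆ N` contradicts `p ∈ M`
            have : p ∈ (N ∩ u) ∪ (cls F p ∩ u) :=
              mem_union.2 (Or.inr (mem_inter.2 ⟨self_mem_cls F p, hpu⟩))
            rw [h1] at this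
            exact disjoint_left.1 heM this hp
          · exact h1
        -- its `M`-part `q ∩ u` is a twin-closed difference containing `p`, so `q ⊆ u`
        have hqu : cls F p ⊆ u := by
          have hpart := inter_mem_diffs_of_twinClosed hF hc2D hMtc
          have e3 : ((N ∩ u) ∪ (cls F p ∩ u)) ∩ M = cls F p ∩ u := by
            ext x
            simp only [mem_inter, mem_union, hN, mem_sdiff, mem_univ, true_and]
            constructor
            · rintro ⟨⟨hxM, _⟩ | hx, hxM'⟩
              · exact absurd hxM' hxM
              · exact hx
            · rintro ⟨hxq, hxu⟩
              exact ⟨Or.inr ⟨hxq, hxu⟩, hq hxq⟩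
          rw [e3] at hpart
          exact (cls_subset_of_twinClosed (twinClosed_of_mem_diffs hpart)
            (mem_inter.2 ⟨self_mem_cls F p, hpu⟩)).trans inter_subset_right
        -- its `N`-part `N ∩ u` is a difference
        have hNuD : N ∩ u ∈ D := by
          have hpart := inter_mem_diffs_of_twinClosed hF hc2D hNtc
          have e3 : ((N ∩ u) ∪ (cls F p ∩ u)) ∩ N = N ∩ u := by
            ext x
            simp only [mem_inter, mem_union, hN, mem_sdiff, mem_univ, true_and]
            constructor
            · rintro ⟨⟨_, hxu⟩ | ⟨hxq, _⟩, hxM⟩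
              · exact ⟨hxM, hxu⟩
              · exact absurd (hq hxq) hxM
            · rintro ⟨hxM, hxu⟩
              exact ⟨Or.inl ⟨hxM, hxu⟩, hxM⟩
          rwa [e3] at hpart
        -- the first cell is `M \ u ∈ D` (it cannot be `e`)
        have hMuD : M \ u ∈ D := by
          have e3 : (M \ cls F p) \ u = M \ u := by
            ext x
            simp only [mem_sdiff]
            constructor
            · rintro ⟨⟨hxM, _⟩, hxu⟩
              exact ⟨hxM, hxu⟩
            · rintro ⟨hxM, hxu⟩
              exact ⟨⟨hxM, fun hxq => hxu (hqu hxq)⟩, hxu⟩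
          rw [e3] at hc1
          rcases mem_insert.1 hc1 with h1 | h1
          · exfalso
            obtain ⟨x, hx⟩ := nonempty_iff_ne_empty.2 hene
            have hxN := heN hx
            rw [← h1] at hx
            exact (mem_sdiff.1 hxN).2 (mem_sdiff.1 hx).1
          · exact h1
        -- hence `u = (N ∩ u) ∪ (M \ (M \ u))` is a member
        have hmem := union_sdiff_mem_of_tight hF hNuD inter_subset_left hMuD sdiff_subset
        rw [Finset.sdiff_sdiff_self_left] at hmem
        have e4 : N ∩ u ∪ M ∩ u = u := by
          ext x
          simp only [mem_union, mem_inter, hN, mem_sdiff, mem_univ, true_and]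
          constructor
          · rintro (⟨_, hxu⟩ | ⟨_, hxu⟩) <;> exact hxu
          · intro hxu
            by_cases hxM : x ∈ M
            · exact Or.inr ⟨hxM, hxu⟩
            · exact Or.inl ⟨hxM, hxu⟩
        rw [e4] at hmem
        exact hu hmem
      exact ⟨fun hpu => absurd hpu hnot, fun h' => absurd h'.2 hσt⟩
  · -- `q ∉ D`: then `p ∉ u`, else `q ⊆ M ∩ u ∈ D`
    have hnot : p ∉ u := by
      intro hpu
      exact hqD (mem_diffs_of_subset_of_twinClosed hF hb
        (cls_subset_of_twinClosed (twinClosed_of_mem_diffs hb) (mem_inter.2 ⟨hp, hpu⟩)) hqtc)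
    exact ⟨fun hpu => absurd hpu hnot, fun h' => absurd h'.1 hqD⟩

/-- **Lemma U, core form (`σ (Rstar F) = true`).** Two non-members with non-member complements
whose required cells all lie in `F \\ F ∪ {e}` coincide. -/
theorem eq_of_cells_subset_insert_aux {F : Finset (Finset α)} (hF : Tight F) (hne : F.Nonempty)
    (σ : Finset α → Bool) {e : Finset α} (he : e ∉ F \\ F) {u : Finset α} (hu : u ∉ F)
    (h : ∀ t ∈ F, Cells (insert e (F \\ F)) t (if σ t = true then u else Finset.univ \ u))
    (hσ : σ (Rstar F) = true) {u' : Finset α} (hu' : u' ∉ F)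
    (huc : Finset.univ \ u ∉ F) (hu'c : Finset.univ \ u' ∉ F)
    (h' : ∀ t ∈ F, Cells (insert e (F \\ F)) t (if σ t = true then u' else Finset.univ \ u')) :
    u' = u := by
  set M := Rstar F with hM
  set N := Finset.univ \ M with hN
  set D := F \\ F with hD
  have hdich := dichotomy_of_tight hF
  have hMF : M ∈ F := Rstar_mem_of_dichotomy hdich hne
  have hene : e ≠ ∅ := ne_empty_of_notMem_diffs hne he
  -- at the member `M`, one of the two cells is the defect
  have key : ∀ v : Finset α, Finset.univ \ v ∉ F →
      Cells (insert e D) M (if σ M = true then v else Finset.univ \ v) →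
      M ∩ v = e ∨ N \ v = e := by
    intro v hvc hc
    rw [hσ] at hc
    simp only [if_true] at hc
    obtain ⟨hc1, hc2⟩ := hc
    have e2 : (Finset.univ \ M) ∩ (Finset.univ \ v) = N \ v := by
      ext x; simp [hN]
    rw [e2] at hc2
    by_contra hcon
    push Not at hcon
    have h1 : M ∩ v ∈ D := (mem_insert.1 hc1).resolve_left hcon.1
    have h2 : N \ v ∈ D := (mem_insert.1 hc2).resolve_left hcon.2
    have := union_sdiff_mem_of_tight hF h2 sdiff_subset h1 inter_subset_left
    have e3 : N \ v ∪ M \ (M ∩ v) = Finset.univ \ v := by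
      ext x
      simp only [mem_union, mem_sdiff, mem_inter, hN, mem_univ, true_and, not_and]
      constructor
      · rintro (⟨_, hxv⟩ | ⟨hxM, hxv⟩)
        · exact hxv
        · exact hxv hxM
      · intro hxv
        by_cases hxM : x ∈ M
        · exact Or.inr ⟨hxM, fun _ => hxv⟩
        · exact Or.inl ⟨hxM, hxv⟩
    rw [e3] at this
    exact hvc this
  rcases key u huc (h M hMF) with hbe | hae <;> rcases key u' hu'c (h' M hMF) with hbe' | hae'
  · -- both defects on the `M` side
    ext x
    by_cases hxM : x ∈ M
    · constructor
      · intro hx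
        have : x ∈ M ∩ u' := mem_inter.2 ⟨hxM, hx⟩
        rw [hbe', ← hbe] at this
        exact (mem_inter.1 this).2
      · intro hx
        have : x ∈ M ∩ u := mem_inter.2 ⟨hxM, hx⟩
        rw [hbe, ← hbe'] at this
        exact (mem_inter.1 this).2
    · rw [mem_iff_of_inter_Rstar_eq hF hne σ he hu h hσ hbe hxM,
        mem_iff_of_inter_Rstar_eq hF hne σ he hu' h' hσ hbe' hxM]
  · -- `e ⊆ M` and `e ⊆ N` is impossible
    exfalso
    apply hene
    rw [eq_empty_iff_forall_notMem]
    intro x hx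
    have hx1 : x ∈ M ∩ u := by rw [hbe]; exact hx
    have hx2 : x ∈ N \ u' := by rw [hae']; exact hx
    exact (mem_sdiff.1 (mem_sdiff.1 hx2).1).2 (mem_inter.1 hx1).1
  · exfalso
    apply hene
    rw [eq_empty_iff_forall_notMem]
    intro x hx
    have hx1 : x ∈ M ∩ u' := by rw [hbe']; exact hx
    have hx2 : x ∈ N \ u := by rw [hae]; exact hx
    exact (mem_sdiff.1 (mem_sdiff.1 hx2).1).2 (mem_inter.1 hx1).1
  · -- both defects on the `N` side
    ext x
    by_cases hxM : x ∈ M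
    · rw [mem_iff_of_sdiff_Rstar_eq hF hne σ he hu h hσ hae hxM,
        mem_iff_of_sdiff_Rstar_eq hF hne σ he hu' h' hσ hae' hxM]
    · have hxN : x ∈ N := mem_sdiff.2 ⟨mem_univ _, hxM⟩
      constructor
      · intro hx
        by_contra hx'
        have : x ∈ N \ u := mem_sdiff.2 ⟨hxN, hx'⟩
        rw [hae, ← hae'] at this
        exact (mem_sdiff.1 this).2 hx
      · intro hx
        by_contra hx'
        have : x ∈ N \ u' := mem_sdiff.2 ⟨hxN, hx'⟩
        rw [hae', ← hae] at this
        exact (mem_sdiff.1 this).2 hx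

end LemmaU

/-- **Lemma U: the defect determines the set.** Let `F` be a tight nonempty family, `σ` a sign
pattern, `e` a non-difference, and `u`, `u'` sets with `u, uᶜ, u', u'ᶜ ∉ F` all of whose required
cells (agreement cells at members with `σ t = true`, disagreement cells elsewhere) lie in
`F \\ F ∪ {e}`. Then `u' = u`. -/
theorem eq_of_cells_subset_insert {F : Finset (Finset α)} (hF : Tight F) (hne : F.Nonempty)
    (σ : Finset α → Bool) {e : Finset α} (he : e ∉ F \\ F) {u u' : Finset α} (hu : u ∉ F)
    (huc : Finset.univ \ u ∉ F) (hu' : u' ∉ F) (hu'c : Finset.univ \ u' ∉ F)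
    (h : ∀ t ∈ F, Cells (insert e (F \\ F)) t (if σ t = true then u else Finset.univ \ u))
    (h' : ∀ t ∈ F, Cells (insert e (F \\ F)) t (if σ t = true then u' else Finset.univ \ u')) :
    u' = u := by
  by_cases hσ : σ (Rstar F) = true
  · exact eq_of_cells_subset_insert_aux hF hne σ he hu h hσ hu' huc hu'c h'
  · -- complement everything: the sign pattern `!σ` has `Rstar F` as an agreement member
    have hσ' : (fun t => !σ t) (Rstar F) = true := by simpa using hσ
    have hsw : ∀ (v : Finset α) (t : Finset α),
        (if (!σ t) = true then Finset.univ \ v else Finset.univ \ (Finset.univ \ v)) =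
          (if σ t = true then v else Finset.univ \ v) := by
      intro v t
      cases hσt : σ t
      · simp
      · simp [Finset.sdiff_sdiff_eq_self (subset_univ v)]
    have hu₁ : Finset.univ \ (Finset.univ \ u) ∉ F := by
      rwa [Finset.sdiff_sdiff_eq_self (subset_univ u)]
    have hu₁' : Finset.univ \ (Finset.univ \ u') ∉ F := by
      rwa [Finset.sdiff_sdiff_eq_self (subset_univ u')]
    have h₁ : ∀ t ∈ F, Cells (insert e (F \\ F)) t
        (if (fun t => !σ t) t = true then Finset.univ \ u else Finset.univ \ (Finset.univ \ u)) := by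
      intro t ht
      show Cells (insert e (F \\ F)) t
        (if (!σ t) = true then Finset.univ \ u else Finset.univ \ (Finset.univ \ u))
      rw [hsw]
      exact h t ht
    have h₁' : ∀ t ∈ F, Cells (insert e (F \\ F)) t
        (if (fun t => !σ t) t = true then Finset.univ \ u' else Finset.univ \ (Finset.univ \ u')) := by
      intro t ht
      show Cells (insert e (F \\ F)) t
        (if (!σ t) = true then Finset.univ \ u' else Finset.univ \ (Finset.univ \ u'))
      rw [hsw]
      exact h' t ht
    have := eq_of_cells_subset_insert_aux hF hne (fun t => !σ t) he huc h₁ hσ' hu'c hu₁ hu₁' h₁'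
    have := congrArg (fun s => Finset.univ \ s) this
    simpa [Finset.sdiff_sdiff_eq_self (subset_univ u), Finset.sdiff_sdiff_eq_self (subset_univ u')]
      using this

/-- **The missing-member reduction.** If `F ∪ {u}` is tight and `u'` has all its required cells
with respect to `(F, σ)`, together with `u \ u'` and `u' \ u`, among the differences of `F ∪ {u}`,
then `u'` or `u'ᶜ` is a member of `F ∪ {u}` — sign `u` as a disagreement member and apply the
general mixed-cell lemma to the tight family `F ∪ {u}`. -/
theorem mem_or_compl_mem_of_tight_insert {F : Finset (Finset α)} {u : Finset α}
    (hF : Tight (insert u F)) (σ : Finset α → Bool) {u' : Finset α}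
    (h : ∀ t ∈ F, Cells (insert u F \\ insert u F) t (if σ t = true then u' else Finset.univ \ u'))
    (h1 : u \ u' ∈ insert u F \\ insert u F) (h2 : u' \ u ∈ insert u F \\ insert u F) :
    u' ∈ insert u F ∨ Finset.univ \ u' ∈ insert u F := by
  refine mem_or_compl_mem_of_tight hF (insert_nonempty u F) u' ?_
  intro t ht
  rcases mem_insert.1 ht with rfl | htF
  · right
    have e1 : t ∩ (Finset.univ \ u') = t \ u' := by ext x; simp
    have e2 : (Finset.univ \ t) ∩ u' = u' \ t := by ext x; simp [and_comm]
    rw [e1, e2]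
    exact ⟨h1, h2⟩
  · have hc := h t htF
    by_cases hσ : σ t = true
    · rw [if_pos hσ] at hc
      exact Or.inl hc
    · rw [if_neg hσ] at hc
      obtain ⟨hc1, hc2⟩ := hc
      rw [Finset.sdiff_sdiff_eq_self (subset_univ u')] at hc2
      exact Or.inr ⟨hc1, hc2⟩

end PercRepro.MSTight
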